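import Summits.QuantumFields.QCD.Theses.SpectralDefectExtinction
import Literature.MathematicalPhysics.QuantumFieldTheory.FermionFlow

/-!
# Sketch — crux-ideate r1 k2 for `SpectralDefectExtinction.TipPricing` (stmt-QuantumFields-8967)

First lemmas of the three idea cards, stated over tree vocabulary (no proofs required at this stage;
each is a `def … : Prop`).  Namespace as for crux ideas.

* card `kyfan-laplacian-lifshitz-floor`: `KyFanRealPartCount`, `HermitianPartIsLaplacian`,
  `RealModesLeLaplacianCount`.
* card `chessboard-tilt-cold-blocks`: `ActionTiltBound`.
* card `excise-the-carrier-flavour-zero`: `WeylMassShift`, `FlavourZeroDeletion`.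
* card `tight-by-volume-at-fixed-k`: `CoerciveBulkResolvent`, `TightByVolumeBookkeeping`.
-/

namespace Summit.QuantumFields.QCD.Cruxes.TipPricing.Ideas

open Literature.MathematicalPhysics Literature.MathematicalPhysics.QuantumLattice
  Literature.MathematicalPhysics.QuantumFieldTheory Literature.Probability.LatticeModels
open Matrix MeasureTheory
open scoped Classical Kronecker ComplexOrder

/-- **Ky Fan real-part counting inequality** (Fan 1950; Bhatia, *Matrix Analysis*, Prop. III.5.3:
the real parts of the eigenvalues of `A` are majorised by the eigenvalues of `Re A = (A + Aᴴ)/2`).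
Counting corollary WHEN `Re A ≥ 0`: for `0 < θ < 1`, `t ≥ 0`,
`(1 − θ)·#{λ ∈ σ(A) : Re λ < t} ≤ #{μ ∈ σ(Re A) : μ < t/θ}` (if `k` eigenvalues of `A` have real part
`< t`, the `k` smallest eigenvalues of `Re A` — all `≥ 0` — sum to `< kt`, so fewer than `θk` of them can be
`≥ t/θ`). Positivity of `Re A` is needed: `A = 3·[[0,−2,−2],[0,0,−2],[0,0,0]]` is nilpotent while
`Re A` has eigenvalues `−6, 3, 3`. Eigenvalues counted with algebraic multiplicity as roots of the
characteristic polynomial. [cite: Fan1950 PNAS 36, 31; Bhatia1997 Prop. III.5.3] -/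
def KyFanRealPartCount : Prop :=
  ∀ (n : ℕ) (A : Matrix (Fin n) (Fin n) ℂ) (t θ : ℝ), 0 < θ → θ < 1 → 0 ≤ t →
    ((1 / 2 : ℂ) • (A + Aᴴ)).PosSemidef →
    (1 - θ) * ((A.charpoly.roots.countP fun z : ℂ => z.re < t) : ℝ) ≤
      ((((1 / 2 : ℂ) • (A + Aᴴ)).charpoly.roots.countP fun z : ℂ => z.re < t / θ) : ℝ)

/-- **The Hermitian part of the massless `r = 1` Wilson–Dirac operator is the covariant Laplacian**:
`D_W(U,0,1) + D_W(U,0,1)ᴴ = −Δ_U ⊗ 1_spin` (the `γ_μ` parts cancel, the `r` parts add; Lüscher's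
`covariantLaplacian` has the tree's link orientation and `Δ = Σ_μ(V T_μ + T_μ† V† ) − 2d`). So
`Re D_W(U,0,1) = W_U := −½ Δ_U ⊗ 1 ≥ 0`. [cite: Luscher2013 (A.4)–(A.5); MontvayMunster1994 §4.2 (4.85)] -/
def HermitianPartIsLaplacian : Prop :=
  ∀ (L : ℕ) [NeZero L] (U : GaugeConfig 4 L ↥(Matrix.specialUnitaryGroup (Fin 3) ℂ)),
    wilsonDirac (fundamentalRep (Fin 3)) U 0 1 + (wilsonDirac (fundamentalRep (Fin 3)) U 0 1)ᴴ =
      - Matrix.reindex (Equiv.prodAssoc _ _ _) (Equiv.prodAssoc _ _ _)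
          (covariantLaplacian (fundamentalRep (Fin 3)) U ⊗ₖ (1 : Matrix (Fin 4) (Fin 4) ℂ))

/-- **Real Wilson–Dirac modes are floored by the covariant Laplacian, with counting** (Ky Fan ∘
`HermitianPartIsLaplacian`): for every `SU(3)` field on every torus, every `t ≥ 0` and `0 < θ < 1`,
`(1 − θ) · #{eigenvalues of D_W(U,0,1) with Re < t} ≤ 4 · #{eigenvalues of W_U = −½Δ_U below t/θ}`
(factor `4` = spin multiplicity). In particular the route's count (a), `#{REAL eigenvalues below t}`,
is bounded by the integrated density of states of a POSITIVE random Schrödinger-type operator — the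
transfer behind the card `kyfan-laplacian-lifshitz-floor`. [cite: Fan1950; hep-lat/0504008] -/
def RealModesLeLaplacianCount : Prop :=
  ∀ (L : ℕ) [NeZero L] (U : GaugeConfig 4 L ↥(Matrix.specialUnitaryGroup (Fin 3) ℂ)) (t θ : ℝ),
    0 < θ → θ < 1 → 0 ≤ t →
    (1 - θ) * (((wilsonDirac (fundamentalRep (Fin 3)) U 0 1).charpoly.roots.countP
        fun z : ℂ => z.re < t) : ℝ) ≤
      4 * ((((-(1 / 2 : ℂ)) • covariantLaplacian (fundamentalRep (Fin 3)) U).charpoly.roots.countP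
        fun z : ℂ => z.re < t / θ) : ℝ)

/-- **Action-tilt large-deviation bound** (the infrared-uniform LDP that needs NO expansion): for the
`SU(3)` Wilson measure on any torus and `0 < β < β'`, tilting by the action itself (which is just the
Wilson measure at `β'`) and `log Z_β − log Z_{β'} = ∫_β^{β'} ⟨S⟩_b db ≥ (β' − β)⟨S⟩_{β'}` (since
`d⟨S⟩_b/db = −Var_b S ≤ 0`) give
`P_β(S ≤ (1−θ)⟨S⟩_β) ≤ exp(−(β'−β)(⟨S⟩_{β'} − (1−θ)⟨S⟩_β))`; with Chatterjee's leading term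
`⟨S⟩_b = (n_dof |Λ| / 2b)(1 + o(1))` the choice `β' = β/(1−θ/2)` makes the exponent `−c θ² |Λ|`,
uniformly in the volume. First lemma of the card `chessboard-tilt-cold-blocks`. [cite: Chatterjee2016; FrohlichIsraelLiebSimon1978] -/
def ActionTiltBound : Prop :=
  ∀ (L : ℕ) [NeZero L] (β β' θ : ℝ), 0 < β → β < β' →
    (wilsonMeasure (d := 4) (L := L) (fundamentalRep (Fin 3)) β)
        {U : GaugeConfig 4 L ↥(Matrix.specialUnitaryGroup (Fin 3) ℂ) |
          wilsonAction (fundamentalRep (Fin 3)) U ≤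
            (1 - θ) * ∫ V, wilsonAction (fundamentalRep (Fin 3)) V
              ∂(wilsonMeasure (d := 4) (L := L) (fundamentalRep (Fin 3)) β)} ≤
      ENNReal.ofReal (Real.exp (-(β' - β) *
        ((∫ V, wilsonAction (fundamentalRep (Fin 3)) V
            ∂(wilsonMeasure (d := 4) (L := L) (fundamentalRep (Fin 3)) β')) -
          (1 - θ) * ∫ V, wilsonAction (fundamentalRep (Fin 3)) V
            ∂(wilsonMeasure (d := 4) (L := L) (fundamentalRep (Fin 3)) β))))

/-- **Weyl mass shift for the Hermitian Wilson–Dirac family** `H(m) = γ₅ D_W(U,m,1) = H(m₀) + (m−m₀)γ₅`,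
`‖γ₅‖ = 1`: an eigenvalue of `H(m₀)` in `[−ε, ε]` forces an eigenvalue of `H(m)` in
`[−ε−|m−m₀|, ε+|m−m₀|]` for EVERY `m` — so one window event at flavour `f₀` makes ALL flavours'
determinants carry a factor `≤ ε + a|m_f − m_{f₀}|/Z`: the flavour zero `a^{N_f}` is deterministic.
First lemma of the card `excise-the-carrier-flavour-zero`. [cite: Bhatia1997 Cor. III.2.6 (Weyl); BerrutoNarayananNeuberger2000] -/
def WeylMassShift : Prop :=
  ∀ (L : ℕ) [NeZero L] (U : GaugeConfig 4 L ↥(Matrix.specialUnitaryGroup (Fin 3) ℂ)) (m₀ m ε : ℝ),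
    (∃ z ∈ (spinorLift gammaFive * wilsonDirac (fundamentalRep (Fin 3)) U m₀ 1).charpoly.roots,
        |z.re| ≤ ε) →
      ∃ z ∈ (spinorLift gammaFive * wilsonDirac (fundamentalRep (Fin 3)) U m 1).charpoly.roots,
        |z.re| ≤ ε + |m - m₀|

/-- **Flavour-zero deletion**: given a window event for flavour `f₀` (an eigenvalue of `H(m_{f₀})` of
modulus `≤ ε`), one root per flavour can be DELETED from `|det H(m_f)| = ∏ |roots|` at the price
`ε + |m_f − m_{f₀}|` each: `∏_f |det D_W(U,m_f,1)| ≤ ∏_f (ε + |m_f − m_{f₀}|) · ∏_f ∏_{roots ≠ deleted} |z|`.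
The deleted weight is regular across the window (its dependence on the carrier's links no longer
vanishes), which is what lets the quenched Wegner mechanism act on the tilted measure. [cite: BerrutoNarayananNeuberger2000 (det factorisation); Wegner1981DensityOfStates] -/
def FlavourZeroDeletion : Prop :=
  ∀ (Nf L : ℕ) [NeZero L] (U : GaugeConfig 4 L ↥(Matrix.specialUnitaryGroup (Fin 3) ℂ))
    (mq : Fin Nf → ℝ) (f₀ : Fin Nf) (ε : ℝ), 0 ≤ ε →
    (∃ z ∈ (spinorLift gammaFive * wilsonDirac (fundamentalRep (Fin 3)) U (mq f₀) 1).charpoly.roots,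
        ‖z‖ ≤ ε) →
      ∃ zdel : Fin Nf → ℂ,
        (∀ f, zdel f ∈
          (spinorLift gammaFive * wilsonDirac (fundamentalRep (Fin 3)) U (mq f) 1).charpoly.roots) ∧
        ∏ f, ‖fermionDet (wilsonDirac (fundamentalRep (Fin 3)) U (mq f) 1)‖ ≤
          ∏ f, ((ε + |mq f - mq f₀|) *
            (((spinorLift gammaFive * wilsonDirac (fundamentalRep (Fin 3)) U (mq f) 1).charpoly.roots.erase
              (zdel f)).map fun z : ℂ => ‖z‖).prod)

/-- **Coercive bulk resolvent** (first lemma of the card `tight-by-volume-at-fixed-k`; deterministic,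
every field, every torus): if the covariant-Laplacian floor of `D_W(U,0,1)` on the support in question
is `lam` (i.e. `lam‖ψ‖² ≤ Re⟨ψ, D_W(U,0,1)ψ⟩` for all `ψ`), then for every `0 ≤ μ < lam` the shifted
operator `D_W(U,0,1) − μ` is coercive: `(lam − μ)²‖ψ‖² ≤ ‖(D_W(U,0,1) − μ)ψ‖²`.  This is the bound that
makes `sign Γ₅(D_W − μ)` exponentially local away from the rare near-flat bubbles in the fixed-`k`
dilute-bubble expansion (numerical-range inverse bound; Cauchy–Schwarz). [cite: Fan1950; Disproof.lean §1 `re_quadForm_wilsonDirac_ge`] -/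
def CoerciveBulkResolvent : Prop :=
  ∀ (L : ℕ) [NeZero L] (U : GaugeConfig 4 L ↥(Matrix.specialUnitaryGroup (Fin 3) ℂ)) (lam μ : ℝ),
    (∀ ψ : TorusSite 4 L × Fin 3 × Fin 4 → ℂ,
        lam * ∑ i, ‖ψ i‖ ^ 2 ≤ (star ψ ⬝ᵥ (wilsonDirac (fundamentalRep (Fin 3)) U 0 1 *ᵥ ψ)).re) →
    0 ≤ μ → μ < lam →
    ∀ ψ : TorusSite 4 L × Fin 3 × Fin 4 → ℂ,
      (lam - μ) ^ 2 * ∑ i, ‖ψ i‖ ^ 2 ≤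
        ∑ i, ‖((wilsonDirac (fundamentalRep (Fin 3)) U 0 1 - (μ : ℂ) • (1 : Matrix _ _ ℂ)) *ᵥ ψ) i‖ ^ 2

/-- **TIGHT by volume — the bookkeeping half** (card `tight-by-volume-at-fixed-k`): if at every step
`k` some torus-size threshold `N₀ k` makes a `k`-indexed family of real quantities `T k N` (the TIGHT
expectations on the torus of side `2N+1`) at least `1` for all `N ≥ N₀ k`, then there is a volume
sequence `L` with `a_k L_k → ∞` along which `T k (L k) ≥ 1` for every `k` — because `tendsto_L` caps
`L_k` from BELOW only. Pure real analysis; it isolates the quantifier loophole of `WindowExtinction`. [folklore] -/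
def TightByVolumeBookkeeping : Prop :=
  ∀ (a : ℕ → ℝ) (_ : ∀ k, 0 < a k) (N₀ : ℕ → ℕ) (T : ℕ → ℕ → ℝ),
    (∀ k N, N₀ k ≤ N → 1 ≤ T k N) →
    ∃ L : ℕ → ℕ, Filter.Tendsto (fun k => a k * L k) Filter.atTop Filter.atTop ∧ ∀ k, 1 ≤ T k (L k)

end Summit.QuantumFields.QCD.Cruxes.TipPricing.Ideas
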